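import Summits.Ventures.GridStability.Bench.WSCC9Deg2ASPdampH12Data2
import Mathlib.Tactic.LinearCombination
import Mathlib.Tactic.Positivity
import Literature.Computation.Certificates.GramSOSRows
import Literature.Computation.Certificates.Blocks
import HarnessLib
-- PORT cert/sos-5/emit_lean.py@eda97b1342a415ef / source cert/A/WSCC9-deg2-A-SPdampH12.json sha256: b1dc5296f4a23d1873a07915f761eb5212b27bc207bec5a7cd56646129c3b531
-- estimated kernel time of this file's `decide`s: 176 s (emitter calibration 2026-08-26; RULING 8 budget 200 s per file)

/-!
# Ventures/GridStability — Bench/WSCC9Deg2ASPdampH12Part2.lean: PART 2 of 4 of certificate file `WSCC9-deg2-A-SPdampH12` (system WSCC9, V degree 2, toolchain A)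

Kernel checks and certified inequalities for the identities `deg2_A_SPdampH12_level_in_ball` of
certificate `WSCC9-deg2-A-SPdampH12` (data in
`Summits.Ventures.GridStability.Bench.WSCC9Deg2ASPdampH12Data`); the conjunction
`deg2_A_SPdampH12_certificate` and the full docstring (three columns, provenance, identity list) are
in `Bench/WSCC9Deg2ASPdampH12.lean`. Split by the emitter so that each file's `decide +kernel` time
stays inside the RULING 8 budget (estimated 176 s here). «algebraic inequalities certified; ROA
inclusion pending Lyapunov/ lemma».
-/

namespace Summit.Ventures.GridStability.Bench.WSCC9

open Literature.Computation.Certificates Literature.Computation.Certificates.SOS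
open Literature.Computation.Certificates.SOS.Poly

/-! ### Kernel checks (`decide +kernel`) — data in `Summits.Ventures.GridStability.Bench.WSCC9Deg2ASPdampH12Data` -/

set_option maxHeartbeats 0 in
/-- KERNEL PSD CHECK `deg2_A_SPdampH12_level_in_ball_free` (size 36): `d ≥ 0` and `Q − Bᵀ·diag d·B` symmetric diagonally dominant; rows in 4 blocks of 10 (`forall_fin_of_blocks`), one `decide` each. [folklore] -/
theorem deg2_A_SPdampH12_level_in_ball_free_valid : deg2_A_SPdampH12_level_in_ball_free.Valid :=
  PSD.IsGramCertDD.intro (by decide +kernel)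
    (PSD.IsDiagDominant.intro
      (forall_fin_of_blocks 10 (by norm_num) (by intro c; fin_cases c <;> decide +kernel))
      (forall_fin_of_blocks 10 (by norm_num) (by intro c; fin_cases c <;> decide +kernel)))

set_option maxHeartbeats 0 in
/-- KERNEL PSD CHECK `deg2_A_SPdampH12_level_in_ball_ineq1` (size 8): `d ≥ 0` and `Q − Bᵀ·diag d·B` symmetric diagonally dominant. [folklore] -/
theorem deg2_A_SPdampH12_level_in_ball_ineq1_valid : deg2_A_SPdampH12_level_in_ball_ineq1.Valid := by
  decide +kernel

set_option maxHeartbeats 0 in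
/-- KERNEL RESIDUAL CHECK `deg2_A_SPdampH12_level_in_ball`: `p − (σ₀ + Σ gᵢσᵢ + Σ hⱼtⱼ)` is the zero polynomial (`residualGR`). [folklore] -/
theorem deg2_A_SPdampH12_level_in_ball_residual : isZero (residualGR deg2_A_SPdampH12_level_in_ball_p deg2_A_SPdampH12_level_in_ball_gs deg2_A_SPdampH12_level_in_ball_hs deg2_A_SPdampH12_level_in_ball_cert) = true := by
  decide +kernel

/-! ### The certified inequalities (README §3 T3; «algebraic inequalities certified; ROA inclusion pending Lyapunov/ lemma») -/

/-- **`deg2_A_SPdampH12_level_in_ball`** (CERTIFIED, model `WSCC9 instance WSCC9-postB-SPdamp-h12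
(model-1 I2 file, f verbatim)`; ALGEBRAIC inequality, ROA inclusion pending Lyapunov/ lemma): r2 -
phi >= 0 on {level - V >= 0} cap {h = 0} (typed inclusion {V <= level} cap {h=0} in D = {phi <= r2},
PARTITION A2) — for every real point satisfying the listed hypotheses (hV, hh1, hh2). [folklore] -/
theorem deg2_A_SPdampH12_level_in_ball (sigma_2 kappa_2 sigma_3 kappa_3 omega_1 omega_2 omega_3 : ℝ) (hV : deg2_A_SPdampH12_V sigma_2 kappa_2 sigma_3 kappa_3 omega_1 omega_2 omega_3 ≤ (30 : ℝ)) (hh1 : deg2_A_SPdampH12_h1 sigma_2 kappa_2 sigma_3 kappa_3 omega_1 omega_2 omega_3 = 0) (hh2 : deg2_A_SPdampH12_h2 sigma_2 kappa_2 sigma_3 kappa_3 omega_1 omega_2 omega_3 = 0) :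
    ((1 : ℝ) / 36) * omega_3 ^ 2 + ((1 : ℝ) / 36) * omega_2 ^ 2 + ((1 : ℝ) / 36) * omega_1 ^ 2 + (1 : ℝ) * kappa_3 ^ 2 + (1 : ℝ) * sigma_3 ^ 2 + (1 : ℝ) * kappa_2 ^ 2 + (1 : ℝ) * sigma_2 ^ 2 ≤ (1 / 2 : ℝ) := by
  simp only [deg2_A_SPdampH12_V, deg2_A_SPdampH12_V_poly, eval_cons, eval_nil, Monomial.eval_eq, Monomial.evalFrom_cons, Monomial.evalFrom_nil,
        vars_cons_zero, vars_cons_succ] at hV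
  push_cast at hV
  simp only [deg2_A_SPdampH12_h1, deg2_A_SPdampH12_h1_poly, eval_cons, eval_nil, Monomial.eval_eq, Monomial.evalFrom_cons, Monomial.evalFrom_nil,
        vars_cons_zero, vars_cons_succ] at hh1
  push_cast at hh1
  simp only [deg2_A_SPdampH12_h2, deg2_A_SPdampH12_h2_poly, eval_cons, eval_nil, Monomial.eval_eq, Monomial.evalFrom_cons, Monomial.evalFrom_nil,
        vars_cons_zero, vars_cons_succ] at hh2
  push_cast at hh2
  have h := nonneg_of_validGR (p := deg2_A_SPdampH12_level_in_ball_p) (gs := deg2_A_SPdampH12_level_in_ball_gs) (hs := deg2_A_SPdampH12_level_in_ball_hs) (cert := deg2_A_SPdampH12_level_in_ball_cert)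
    deg2_A_SPdampH12_level_in_ball_free_valid
    (by
      intro σ hσ
      simp only [deg2_A_SPdampH12_level_in_ball_cert, deg2_A_SPdampH12_level_in_ball_ineqMult, List.mem_cons, List.not_mem_nil, or_false] at hσ
      rcases hσ with rfl
      · exact deg2_A_SPdampH12_level_in_ball_ineq1_valid)
    deg2_A_SPdampH12_level_in_ball_residual (vars [sigma_2, kappa_2, sigma_3, kappa_3, omega_1, omega_2, omega_3])
    (by
      intro g hg
      simp only [deg2_A_SPdampH12_level_in_ball_gs, List.mem_cons, List.not_mem_nil, or_false] at hg
      rcases hg with rfl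
      · simp only [eval_cons, eval_nil, Monomial.eval_eq, Monomial.evalFrom_cons, Monomial.evalFrom_nil,
        vars_cons_zero, vars_cons_succ]
        push_cast
        linear_combination hV)
    (by
      intro q hq
      simp only [deg2_A_SPdampH12_level_in_ball_hs, List.mem_cons, List.not_mem_nil, or_false] at hq
      rcases hq with rfl | rfl
      · simp only [eval_cons, eval_nil, Monomial.eval_eq, Monomial.evalFrom_cons, Monomial.evalFrom_nil,
        vars_cons_zero, vars_cons_succ]
        push_cast
        linear_combination hh1
      · simp only [eval_cons, eval_nil, Monomial.eval_eq, Monomial.evalFrom_cons, Monomial.evalFrom_nil,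
        vars_cons_zero, vars_cons_succ]
        push_cast
        linear_combination hh2)
  simp only [deg2_A_SPdampH12_level_in_ball_p, eval_cons, eval_nil, Monomial.eval_eq, Monomial.evalFrom_cons, Monomial.evalFrom_nil,
        vars_cons_zero, vars_cons_succ] at h
  push_cast at h
  linear_combination h

end Summit.Ventures.GridStability.Bench.WSCC9
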